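/-
Copyright: the b2b-balaban T⁴-continuum CRUX team, row NE7b OWNER lineage `t4-ne7b-p1` (gen 105). Project licence.
-/
import Summits.QuantumFields.BalabanUV.T4Continuum.Spine.NE7b.GaussianDominatedMoment

/-!
# The Gaussian domination lemma UNDER SMALL-FIELD RESTRICTION: a one-step kernel `∝ F·e^{−S}` with `0 ≤ F ≤ 1` (characteristic
# functions) whose large-field mass is small has the same volume-extensive, coupling-free exponential moments, in ITS OWN normalisation
# (row NE7b, node U5c; kernel theorems of real analysis — print's «𝐑-quotients determined by small field effective actions only» in the
# Gaussian model)

Cell `pub-balaban`, sub-cell `t4`, spine estimate NE7b (`T4WeightBudget.RelWeightBound`; the cell's OWN estimate — NOT PRINTED in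
[Bałaban 1983–89], NOT PROVED).  Crux-route work under `Spine/NE7b/` by the row's OWNER; NOTHING of Bałaban's is named or asserted;
no `T4Continuum/Support` leaf typed; zero `sorry`.

WHY.  `…NE7b.GaussianDominatedMoment` proved the [B16] p. 383 l. 21–28 sentence for a PURE Gaussian `e^{−xᵀSx}`: the moment of a
`δ`-dominated rank-`≤ r` form costs `(√(1−δ))⁻¹ ^ r`, whatever the coupling.  In `LocCondStability` the denominator is the pinned term's
OWN state, and a one-step fluctuation kernel of Bałaban's kind is a Gaussian RESTRICTED by small-field characteristic functions —
density `∝ F·e^{−S}` with `0 ≤ F ≤ 1` ([Balaban1989LargeFieldI] (0.3)–(0.5) pp. 176–177: the 𝐑-operation's quotients are «determined by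
small field effective actions only», i.e. `∫ F e^{−S} ≈ ∫ e^{−S}`).  THIS FILE closes that gap in the model: if the LARGE-FIELD MASS is
small, `∫ (1 − F) e^{−S} ≤ η·∫ e^{−S}` with `η < 1`, then in the restricted kernel's own normalisation the moment is at most
`(√(1−δ))⁻¹ ^ r ∕ (1 − η)` (`restrictedMoment_le`), and `η` itself is supplied by the UNION BOUND over the large-field conditions composed
with the Gaussian tail of the previous file (`largeFieldMass_le`): `η ≤ Σ_b e^{−θ_b}·(√(1−δ))⁻¹ ^ {r_b}` when `1 − F ≤ Σ_b 𝟙{θ_b ≤ xᵀQ_b x}`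
with each `Q_b` `δ`-dominated of rank `≤ r_b` — small exactly when the thresholds `θ_b` are large («p₀(g) large», [B16] p. 387 (1.88)).

WHAT IS PROVED ([folklore]; Bochner-integral bookkeeping over the previous file):
* §1 `continuous_qf`, `measurableSet_qf_ge`, `integrable_exp_neg_qf`, `integrable_indicator_mul_exp_neg_qf`, `integrable_bdd_mul_exp_neg_qf`.
* §2 **`largeFieldMass_le`** (union bound × Gaussian tail).
* §3 **`restrictedMoment_le`** (`∫ F e^{Q} e^{−S} ≤ ((√(1−δ))⁻¹ ^ r ∕ (1 − η)) · ∫ F e^{−S}`), `integral_restricted_pos`,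
  **`restrictedGaussianMoment_le`** (normalised form) and `restrictedCost_eq_exp` (the cost is `e^{b}` with
  `b = r·(−½ log(1−δ)) − log(1−η)` — still extensive in `r`, coupling-free, plus an `O(1)` for `η ≤ ½`).
* §4 THE DISPLAYED DATA IN PRINT'S CURRENCY: `rank_le_card_of_cols_subset` (a form on the variables of `Z` has rank `≤ #Z`),
  `dominated_of_coercive` (`S ≥ c₀·1`, `Q ≤ q₀·1` ⟹ `Q ≤ (q₀∕c₀)·S`), `posDef_of_coercive`, **`gaussianMoment_le_of_coercive`**
  (uniform coercivity `c₀` of the background-dependent fluctuation form + a local sacrificed form of size `q₀ < c₀` on `Z` ⟹ moment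
  `≤ (√(1 − q₀∕c₀))⁻¹ ^ #Z`, uniform in the background and the coupling).

NOT HERE (honest).  The non-Gaussian small-field remainder of the effective action (its positivity ∕ smallness is [B15] (0.3)–(0.5)'s
content proper) and the identification of Bałaban's live-index kernels with such restricted Gaussians — the (A1c) INSTANCE, NC-NE7b-α
UNRULED.  BY-NAME EFFECT ON THE WALL: `LocCondStability` for small-field-restricted Gaussian kernels is reduced to displayed linear-algebra
data + displayed thresholds; nothing of Bałaban's is discharged.  NE7b NOT PRINTED ∕ NOT PROVED; spine PROVED 0∕9; rung (B)+1 on a FINITE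
torus — NOT infinite volume, NOT the mass gap, NOT Clay.
HONEST DEPENDENCY: continuum YM on T⁴ ⇐ BetaPertH ∧ nine spine estimates (0/9 proved); BetaPertH ⇐ (D1) ∧ (D4) ∧ CAP+tail.
-/

set_option autoImplicit false

open Matrix Finset MeasureTheory Real
open Summit.QuantumFields.BalabanUV.T4Continuum.NE7b.QuadFormSimDiag
open Summit.QuantumFields.BalabanUV.T4Continuum.NE7b.GaussianDominatedMoment

namespace Summit.QuantumFields.BalabanUV.T4Continuum.NE7b.GaussianRestrictedMoment

variable {n : Type*} [Fintype n] [DecidableEq n]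

/-! ## §1 Measurability ∕ integrability bookkeeping -/

omit [DecidableEq n] in
/-- A quadratic form is continuous. [folklore] -/
theorem continuous_qf (M : Matrix n n ℝ) : Continuous fun x : n → ℝ => x ⬝ᵥ (M *ᵥ x) :=
  continuous_id.dotProduct (continuous_const.matrix_mulVec continuous_id)

omit [DecidableEq n] in
/-- A large-field event `{θ ≤ xᵀMx}` is measurable. [folklore] -/
theorem measurableSet_qf_ge (M : Matrix n n ℝ) (θ : ℝ) : MeasurableSet {x : n → ℝ | θ ≤ x ⬝ᵥ (M *ᵥ x)} :=
  measurableSet_le measurable_const (continuous_qf M).measurable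

/-- The Gaussian of a positive-definite form is integrable. [folklore] -/
theorem integrable_exp_neg_qf {S : Matrix n n ℝ} (hS : S.PosDef) :
    Integrable (fun x : n → ℝ => exp (-(x ⬝ᵥ (S *ᵥ x)))) := by
  have h := integrable_exp_qf_mul_exp_neg_qf (Q := 0) (δ := 0) hS Matrix.PosSemidef.zero
    (by rw [zero_smul, sub_zero]; exact Matrix.PosSemidef.zero) zero_lt_one
  refine h.congr (Filter.Eventually.of_forall fun x => ?_)
  simp only [zero_mulVec, dotProduct_zero, exp_zero, one_mul]

/-- A function with values in `[0, 1]` times the Gaussian is integrable (given a.e.-strong measurability). [folklore] -/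
theorem integrable_bdd_mul_exp_neg_qf {S : Matrix n n ℝ} (hS : S.PosDef) {F : (n → ℝ) → ℝ} (hF0 : ∀ x, 0 ≤ F x)
    (hF1 : ∀ x, F x ≤ 1) (hFm : AEStronglyMeasurable F volume) :
    Integrable (fun x : n → ℝ => F x * exp (-(x ⬝ᵥ (S *ᵥ x)))) :=
  (integrable_exp_neg_qf hS).bdd_mul hFm (Filter.Eventually.of_forall fun x => by
    rw [Real.norm_eq_abs, abs_of_nonneg (hF0 x)]; exact hF1 x)

/-- The indicator of a large-field event times the Gaussian is integrable. [folklore] -/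
theorem integrable_indicator_mul_exp_neg_qf {S : Matrix n n ℝ} (hS : S.PosDef) (M : Matrix n n ℝ) (θ : ℝ) :
    Integrable (fun x : n → ℝ => Set.indicator {x | θ ≤ x ⬝ᵥ (M *ᵥ x)} (fun _ => (1 : ℝ)) x * exp (-(x ⬝ᵥ (S *ᵥ x)))) :=
  integrable_bdd_mul_exp_neg_qf hS (fun x => Set.indicator_nonneg (fun _ _ => zero_le_one) x)
    (fun x => Set.indicator_le_self' (fun _ _ => zero_le_one) x)
    ((measurable_const.indicator (measurableSet_qf_ge M θ)).aestronglyMeasurable)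

/-! ## §2 The large-field mass: union bound × Gaussian tail -/

/-- **THE LARGE-FIELD MASS OF A RESTRICTED GAUSSIAN IS SMALL** (union bound over the large-field conditions, each estimated by the
Gaussian tail `…GaussianDominatedMoment.integral_indicator_le_of_dominated`).  If the defect of the characteristic function is covered
by finitely many large-field events, `1 − F(x) ≤ Σ_{b ∈ B} 𝟙{θ_b ≤ xᵀQ_b x}`, each `Q_b` positive semidefinite, `δ`-dominated by the
positive-definite `S` and of rank `≤ r_b`, then `∫ (1 − F) e^{−xᵀSx} ≤ (Σ_b e^{−θ_b}·(√(1−δ))⁻¹ ^ {r_b}) · ∫ e^{−xᵀSx}`. [folklore] -/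
theorem largeFieldMass_le {ι : Type*} (B : Finset ι) {S : Matrix n n ℝ} (Qb : ι → Matrix n n ℝ) (θ : ι → ℝ) (rb : ι → ℕ)
    {δ : ℝ} (hS : S.PosDef) (hQ : ∀ b ∈ B, (Qb b).PosSemidef) (hdom : ∀ b ∈ B, (δ • S - Qb b).PosSemidef) (hδ0 : 0 ≤ δ)
    (hδ : δ < 1) (hr : ∀ b ∈ B, (Qb b).rank ≤ rb b) {F : (n → ℝ) → ℝ} (hF1 : ∀ x, F x ≤ 1)
    (hcov : ∀ x, 1 - F x ≤ ∑ b ∈ B, Set.indicator {x | θ b ≤ x ⬝ᵥ (Qb b *ᵥ x)} (fun _ => (1 : ℝ)) x) :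
    ∫ x, (1 - F x) * exp (-(x ⬝ᵥ (S *ᵥ x))) ≤
      (∑ b ∈ B, exp (-θ b) * (√(1 - δ))⁻¹ ^ rb b) * ∫ x, exp (-(x ⬝ᵥ (S *ᵥ x))) := by
  have hint : ∀ b ∈ B, Integrable (fun x : n → ℝ =>
      Set.indicator {x | θ b ≤ x ⬝ᵥ (Qb b *ᵥ x)} (fun _ => (1 : ℝ)) x * exp (-(x ⬝ᵥ (S *ᵥ x)))) :=
    fun b _ => integrable_indicator_mul_exp_neg_qf hS (Qb b) (θ b)
  calc ∫ x, (1 - F x) * exp (-(x ⬝ᵥ (S *ᵥ x)))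
      ≤ ∫ x, ∑ b ∈ B, Set.indicator {x | θ b ≤ x ⬝ᵥ (Qb b *ᵥ x)} (fun _ => (1 : ℝ)) x * exp (-(x ⬝ᵥ (S *ᵥ x))) := by
        refine integral_mono_of_nonneg (Filter.Eventually.of_forall fun x => ?_) (integrable_finsetSum B hint)
          (Filter.Eventually.of_forall fun x => ?_)
        · exact mul_nonneg (by linarith [hF1 x]) (exp_pos _).le
        · have h := mul_le_mul_of_nonneg_right (hcov x) (exp_pos (-(x ⬝ᵥ (S *ᵥ x)))).le
          simpa only [Finset.sum_mul] using h
    _ = ∑ b ∈ B, ∫ x, Set.indicator {x | θ b ≤ x ⬝ᵥ (Qb b *ᵥ x)} (fun _ => (1 : ℝ)) x * exp (-(x ⬝ᵥ (S *ᵥ x))) :=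
        integral_finsetSum B hint
    _ ≤ ∑ b ∈ B, exp (-θ b) * (√(1 - δ))⁻¹ ^ rb b * ∫ x, exp (-(x ⬝ᵥ (S *ᵥ x))) :=
        Finset.sum_le_sum fun b hb => integral_indicator_le_of_dominated hS (hQ b hb) (hdom b hb) hδ0 hδ (hr b hb) (θ b)
    _ = (∑ b ∈ B, exp (-θ b) * (√(1 - δ))⁻¹ ^ rb b) * ∫ x, exp (-(x ⬝ᵥ (S *ᵥ x))) := by rw [Finset.sum_mul]

/-! ## §3 The moment in the restricted kernel's own normalisation -/

/-- **THE RESTRICTED MOMENT.**  For `0 ≤ F ≤ 1` with large-field mass `∫ (1 − F) e^{−S} ≤ η·∫ e^{−S}`, `η < 1`, and a `δ`-dominated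
rank-`≤ r` form `Q`: `∫ F·e^{xᵀQx}·e^{−xᵀSx} ≤ ((√(1−δ))⁻¹ ^ r ∕ (1 − η)) · ∫ F·e^{−xᵀSx}` — the Gaussian domination lemma in the
restricted kernel's OWN normalisation, at the price `(1 − η)⁻¹`. [folklore] -/
theorem restrictedMoment_le {S Q : Matrix n n ℝ} {δ η : ℝ} {r : ℕ} (hS : S.PosDef) (hQ : Q.PosSemidef)
    (hdom : (δ • S - Q).PosSemidef) (hδ0 : 0 ≤ δ) (hδ : δ < 1) (hr : Q.rank ≤ r) {F : (n → ℝ) → ℝ} (hF0 : ∀ x, 0 ≤ F x)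
    (hF1 : ∀ x, F x ≤ 1) (hFm : AEStronglyMeasurable F volume) (hη : η < 1)
    (hmass : ∫ x, (1 - F x) * exp (-(x ⬝ᵥ (S *ᵥ x))) ≤ η * ∫ x, exp (-(x ⬝ᵥ (S *ᵥ x)))) :
    ∫ x, F x * (exp (x ⬝ᵥ (Q *ᵥ x)) * exp (-(x ⬝ᵥ (S *ᵥ x)))) ≤
      ((√(1 - δ))⁻¹ ^ r / (1 - η)) * ∫ x, F x * exp (-(x ⬝ᵥ (S *ᵥ x))) := by
  set I₀ : ℝ := ∫ x, exp (-(x ⬝ᵥ (S *ᵥ x))) with hI₀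
  set IF : ℝ := ∫ x, F x * exp (-(x ⬝ᵥ (S *ᵥ x))) with hIF
  have h1η : 0 < 1 - η := by linarith
  -- the restricted normalisation is comparable to the free one: `(1 − η) I₀ ≤ IF`
  have hsplit : ∫ x, (1 - F x) * exp (-(x ⬝ᵥ (S *ᵥ x))) = I₀ - IF := by
    have e : ∀ x : n → ℝ, (1 - F x) * exp (-(x ⬝ᵥ (S *ᵥ x))) =
        exp (-(x ⬝ᵥ (S *ᵥ x))) - F x * exp (-(x ⬝ᵥ (S *ᵥ x))) := fun x => by ring
    simp_rw [e]
    exact integral_sub (integrable_exp_neg_qf hS) (integrable_bdd_mul_exp_neg_qf hS hF0 hF1 hFm)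
  have hIF : (1 - η) * I₀ ≤ IF := by rw [hsplit] at hmass; linarith
  -- the numerator only shrinks under `F ≤ 1`
  have hnum : ∫ x, F x * (exp (x ⬝ᵥ (Q *ᵥ x)) * exp (-(x ⬝ᵥ (S *ᵥ x)))) ≤
      ∫ x, exp (x ⬝ᵥ (Q *ᵥ x)) * exp (-(x ⬝ᵥ (S *ᵥ x))) := by
    refine integral_mono_of_nonneg (Filter.Eventually.of_forall fun x => ?_)
      (integrable_exp_qf_mul_exp_neg_qf hS hQ hdom hδ) (Filter.Eventually.of_forall fun x => ?_)
    · exact mul_nonneg (hF0 x) (mul_nonneg (exp_pos _).le (exp_pos _).le)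
    · have h := mul_le_mul_of_nonneg_right (hF1 x) (mul_nonneg (exp_pos (x ⬝ᵥ (Q *ᵥ x))).le (exp_pos (-(x ⬝ᵥ (S *ᵥ x)))).le)
      simpa only [one_mul] using h
  have hc : 0 ≤ (√(1 - δ))⁻¹ ^ r := pow_nonneg (inv_nonneg.2 (Real.sqrt_nonneg _)) r
  calc ∫ x, F x * (exp (x ⬝ᵥ (Q *ᵥ x)) * exp (-(x ⬝ᵥ (S *ᵥ x))))
      ≤ (√(1 - δ))⁻¹ ^ r * I₀ := hnum.trans (integral_exp_qf_le_of_dominated hS hQ hdom hδ0 hδ hr)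
    _ ≤ (√(1 - δ))⁻¹ ^ r * (IF / (1 - η)) := mul_le_mul_of_nonneg_left ((le_div_iff₀ h1η).2 (by linarith)) hc
    _ = ((√(1 - δ))⁻¹ ^ r / (1 - η)) * IF := by ring

/-- The restricted normalisation is positive as soon as the large-field mass is `< 1` of the free one. [folklore] -/
theorem integral_restricted_pos {S : Matrix n n ℝ} {η : ℝ} (hS : S.PosDef) {F : (n → ℝ) → ℝ} (hF0 : ∀ x, 0 ≤ F x)
    (hF1 : ∀ x, F x ≤ 1) (hFm : AEStronglyMeasurable F volume) (hη : η < 1)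
    (hmass : ∫ x, (1 - F x) * exp (-(x ⬝ᵥ (S *ᵥ x))) ≤ η * ∫ x, exp (-(x ⬝ᵥ (S *ᵥ x)))) :
    0 < ∫ x, F x * exp (-(x ⬝ᵥ (S *ᵥ x))) := by
  have hsplit : ∫ x, (1 - F x) * exp (-(x ⬝ᵥ (S *ᵥ x))) =
      (∫ x, exp (-(x ⬝ᵥ (S *ᵥ x)))) - ∫ x, F x * exp (-(x ⬝ᵥ (S *ᵥ x))) := by
    have e : ∀ x : n → ℝ, (1 - F x) * exp (-(x ⬝ᵥ (S *ᵥ x))) =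
        exp (-(x ⬝ᵥ (S *ᵥ x))) - F x * exp (-(x ⬝ᵥ (S *ᵥ x))) := fun x => by ring
    simp_rw [e]
    exact integral_sub (integrable_exp_neg_qf hS) (integrable_bdd_mul_exp_neg_qf hS hF0 hF1 hFm)
  have h0 := integral_exp_neg_qf_pos hS
  rw [hsplit] at hmass
  nlinarith

/-- **NORMALISED FORM**: in the restricted kernel's own normalisation the expectation of `e^{xᵀQx}` is at most
`(√(1−δ))⁻¹ ^ r ∕ (1 − η)`. [folklore] -/
theorem restrictedGaussianMoment_le {S Q : Matrix n n ℝ} {δ η : ℝ} {r : ℕ} (hS : S.PosDef) (hQ : Q.PosSemidef)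
    (hdom : (δ • S - Q).PosSemidef) (hδ0 : 0 ≤ δ) (hδ : δ < 1) (hr : Q.rank ≤ r) {F : (n → ℝ) → ℝ} (hF0 : ∀ x, 0 ≤ F x)
    (hF1 : ∀ x, F x ≤ 1) (hFm : AEStronglyMeasurable F volume) (hη : η < 1)
    (hmass : ∫ x, (1 - F x) * exp (-(x ⬝ᵥ (S *ᵥ x))) ≤ η * ∫ x, exp (-(x ⬝ᵥ (S *ᵥ x)))) :
    (∫ x, F x * (exp (x ⬝ᵥ (Q *ᵥ x)) * exp (-(x ⬝ᵥ (S *ᵥ x))))) / (∫ x, F x * exp (-(x ⬝ᵥ (S *ᵥ x)))) ≤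
      (√(1 - δ))⁻¹ ^ r / (1 - η) :=
  (div_le_iff₀ (integral_restricted_pos hS hF0 hF1 hFm hη hmass)).2
    (restrictedMoment_le hS hQ hdom hδ0 hδ hr hF0 hF1 hFm hη hmass)

/-- The restricted cost in exponential currency: `(√(1−δ))⁻¹ ^ r ∕ (1 − η) = e^{r·(−log(1−δ)∕2) + (−log(1−η))}` — `b` is still
extensive in `r` and coupling-free, plus `−log(1−η) ≤ log 2` once the large-field mass is at most half. [folklore] -/
theorem restrictedCost_eq_exp {δ η : ℝ} (hδ : δ < 1) (hη : η < 1) (r : ℕ) :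
    (√(1 - δ))⁻¹ ^ r / (1 - η) = exp (r * (-Real.log (1 - δ) / 2) + -Real.log (1 - η)) := by
  rw [Real.exp_add, ← inv_sqrt_pow_eq_exp hδ, Real.exp_neg, Real.exp_log (by linarith : 0 < 1 - η), div_eq_mul_inv]

/-! ## §4 The displayed data in print's currency: UNIFORM COERCIVITY of the (background-dependent) fluctuation form and a LOCAL
sacrificed form — then `δ = q₀ ∕ c₀` and `r = #Z`, whatever the background -/

/-- A matrix whose columns outside the coordinate set `Z` vanish (a form living on the variables of the region `Z`) has rank `≤ #Z`.
[folklore] -/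
theorem rank_le_card_of_cols_subset (Q : Matrix n n ℝ) (Z : Finset n) (hQZ : ∀ i j, j ∉ Z → Q i j = 0) :
    Q.rank ≤ Z.card := by
  classical
  set P : Matrix n n ℝ := diagonal fun j => if j ∈ Z then (1 : ℝ) else 0 with hP
  have e : Q = Q * P := by
    ext i j
    rw [hP, mul_diagonal]
    by_cases hj : j ∈ Z
    · rw [if_pos hj, mul_one]
    · rw [if_neg hj, mul_zero, hQZ i j hj]
  have hcard : Fintype.card {j // (fun j => if j ∈ Z then (1 : ℝ) else 0) j ≠ 0} = Z.card := by
    rw [Fintype.card_subtype]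
    congr 1
    ext j
    simp only [ne_eq, ite_eq_right_iff, one_ne_zero, imp_false, not_not, Finset.mem_filter, Finset.mem_univ, true_and]
  calc Q.rank = (Q * P).rank := by rw [← e]
    _ ≤ P.rank := rank_mul_le_right Q P
    _ = Z.card := by rw [hP, rank_diagonal, hcard]

omit [Fintype n] in
/-- **DOMINATION FROM COERCIVITY.**  If the fluctuation form is uniformly coercive, `S ≥ c₀·1` (`c₀ > 0`), and the sacrificed form is
bounded, `Q ≤ q₀·1` (`q₀ ≥ 0`), then `Q ≤ (q₀∕c₀)·S`. [folklore] -/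
theorem dominated_of_coercive {S Q : Matrix n n ℝ} {c₀ q₀ : ℝ} (hc₀ : 0 < c₀) (hq₀ : 0 ≤ q₀)
    (hS : (S - c₀ • (1 : Matrix n n ℝ)).PosSemidef) (hQ : (q₀ • (1 : Matrix n n ℝ) - Q).PosSemidef) :
    ((q₀ / c₀) • S - Q).PosSemidef := by
  have e : (q₀ / c₀) • S - Q = (q₀ / c₀) • (S - c₀ • (1 : Matrix n n ℝ)) + (q₀ • (1 : Matrix n n ℝ) - Q) := by
    rw [smul_sub, smul_smul, div_mul_cancel₀ q₀ hc₀.ne']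
    abel
  rw [e]
  exact (hS.smul (div_nonneg hq₀ hc₀.le)).add hQ

omit [Fintype n] in
/-- A uniformly coercive form is positive definite. [folklore] -/
theorem posDef_of_coercive {S : Matrix n n ℝ} {c₀ : ℝ} (hc₀ : 0 < c₀) (hS : (S - c₀ • (1 : Matrix n n ℝ)).PosSemidef) :
    S.PosDef := by
  have e : S = (S - c₀ • (1 : Matrix n n ℝ)) + c₀ • (1 : Matrix n n ℝ) := by abel
  rw [e]
  exact Matrix.PosDef.posSemidef_add hS (Matrix.PosDef.one.smul hc₀)

/-- **THE CARRIER BOUND IN PRINT'S CURRENCY** (positivity constant `c₀` of the fluctuation form, [Balaban1989LargeFieldII] p. 383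
«positivity properties of the quadratic forms»; size `q₀ < c₀` of the sacrificed LOCAL form on the region `Z`): for ANY form `S` with
`S ≥ c₀·1` — e.g. the fluctuation form in any small-field background — and any positive-semidefinite `Q ≤ q₀·1` living on the variables
of `Z`, the Gaussian expectation of `e^{xᵀQx}` is at most `(√(1 − q₀∕c₀))⁻¹ ^ #Z`: EXTENSIVE IN `#Z`, uniform in the background (only
`c₀` enters) and in the coupling (scale `S, Q, c₀, q₀` together). [folklore] -/
theorem gaussianMoment_le_of_coercive {S Q : Matrix n n ℝ} {c₀ q₀ : ℝ} (Z : Finset n) (hc₀ : 0 < c₀) (hq₀ : 0 ≤ q₀)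
    (hqc : q₀ < c₀) (hS : (S - c₀ • (1 : Matrix n n ℝ)).PosSemidef) (hQ : Q.PosSemidef)
    (hQq : (q₀ • (1 : Matrix n n ℝ) - Q).PosSemidef) (hQZ : ∀ i j, j ∉ Z → Q i j = 0) :
    (∫ x, exp (x ⬝ᵥ (Q *ᵥ x)) * exp (-(x ⬝ᵥ (S *ᵥ x)))) / (∫ x, exp (-(x ⬝ᵥ (S *ᵥ x)))) ≤
      (√(1 - q₀ / c₀))⁻¹ ^ Z.card :=
  gaussianMoment_le_of_dominated (posDef_of_coercive hc₀ hS) hQ (dominated_of_coercive hc₀ hq₀ hS hQq)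
    (div_nonneg hq₀ hc₀.le) ((div_lt_one hc₀).2 hqc) (rank_le_card_of_cols_subset Q Z hQZ)

end Summit.QuantumFields.BalabanUV.T4Continuum.NE7b.GaussianRestrictedMoment
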